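import Literature.NumberTheory.EllipticCurves.Rank1Residual.MuLambdaCarriers
import Literature.NumberTheory.IwasawaTheory.ClassicalMuInvariant
import Literature.NumberTheory.EllipticCurves.FineSelmerClassGroupCriterion
import Literature.NumberTheory.EllipticCurves.DivisionField
import Literature.NumberTheory.EllipticCurves.GaloisAction
import HarnessLib

/-!
# First-layer class-group CERTIFICATES for statement (A) of Coates–Sujatha at a pair `(E, p)`: the
# per-pair predicates «clean», «tame», the torsion-point field `ℚ(P)`, mod-`p` capitulation in the first
# layer, and the two certificates δ (`rank_p Cl(ℚ₁(P)) ≤ p − 1`) and ε (capitulation) — definitions only,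
# plus the per-pair glue «criterion ∧ certificate ⟹ (A) ⟹ Kato divisibility at the pair»

Topic `NumberTheory/EllipticCurves/Rank1Residual` (namespace = path).  Cell `bsd-f3-mu` (D-0131 (3)),
typer seat; transcription of the `-desc` lens's generation-2 vocabulary (MEMO-desc §10 «FIRST-LAYER GAP»,
`HOME/desc/Sketch2…3.lean`, Sketch3 sha16 e2de64f946f7738f, rc 0; refuter `-ref1` g2 §3.4: statements
faithful, BC7 3/3 CLEAN, the two criteria THEOREM-GRADE on paper — refuter `-ref2` g3: the criteria are
NOT in print as stated; classical skeleton = Lang, *Cyclotomic Fields I–II* Ch. 13 §1 Lemma 3).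
DEFINITIONS with bodies and PREDICATES on pairs; nothing is asserted about any pair; no new named fact.

WHAT (the source's dictionary, DRS 2023 §3 / CS05 §3, read on a CLEAN pair).  For `E/ℚ`, `p` odd,
`E[p]` irreducible, `p ∤ #Gal(ℚ(E[p])/ℚ)` («tame», automatic when the image is a proper subgroup —
Serre), and `E(ℚ_v)[p] = 0` at `v = p` and at the bad places («clean», DRS's hypothesis (c3), spelled as
the `hloc` binder of the tree fact `DeoRaySujatha2023.thm39_…`), the residual fine Selmer group over the
cyclotomic tower is governed by PLAIN class groups of the torsion-point fields `ℚ_n(P)`; Deo–Ray–Sujatha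
Thm 3.9 (layer 0: `p ∤ h` ⟹ (A)) is the tree fact `DeoRaySujatha2023.thm39_…`; the `-desc` lens adds two
first-layer certificates: δ = «`rank_p Cl(ℚ₁(P)) ≤ p − 1`» and ε = «`Cl(ℚ(P))/p → Cl(ℚ₁(P))/p` is
zero» (contains DRS's α), each claimed to imply (A) at the pair (paper proofs MEMO-desc §10.1–10.2; the
class-wide criteria are obligation nodes Summits-side, `SmallImageMu/FirstLayerCriteria.lean`, and enter
the glue below only as HYPOTHESES).

* `CleanAt W p`, `TameAt W p`, `pointField W p P` (= the fixed field of `Stab_{Γ_ℚ}(P)`, the term used by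
  `SmallImageMu.TorsionPointFieldMuSufficesOnClassX9`), `ModPCapitulationInFirstLayer κ`,
  `FirstLayerRankCertAt W p` (δ), `FirstLayerCapitulationCertAt W p` (ε) — verbatim the audited Sketch3.
* Glue (proved, per pair, criteria as hypotheses): `ConjAAt` from a certificate; then, by the carriers'
  per-pair engine `ConjAAt.katoDivisibilityAt` (T0 proved + S-W⁺ hypothesis + F1 + BCS (a)), Kato's
  integral divisibility AT THE PAIR, and with a unit coefficient of `L_p` also `μ(X) = 0`.

References: [DeoRaySujatha2023] §3 (c1)–(c3), Thm. 3.9, §5 Lemma 5.1; [CoatesSujatha2005] §3;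
[Lang1990] Ch. 13 §1 Lemma 3 (first-layer ranks); [Serre1972] §4 (image of `ρ̄`); [Kato2004Asterisque]
§17.13; HOME MEMO-desc.md §10, desc/Sketch3.lean, REF1-AUDIT.md §3.4, REF2-LITMAP.md §3.
-/

noncomputable section

open scoped Classical MatrixGroups ModularForm nonZeroDivisors

open CongruenceSubgroup WeierstrassCurve Literature.NumberTheory.EllipticCurves
  Literature.NumberTheory.EllipticCurves.ModularForms Literature.NumberTheory.IwasawaTheory
  IsDedekindDomain NumberField

namespace Literature.NumberTheory.EllipticCurves.Rank1Residual

/-! ### §1 Predicates on a pair `(E, p)` -/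

/-- **`CleanAt W p` — the pair is CLEAN** (Deo–Ray–Sujatha's hypothesis (c3): «`E(ℚ_v)[p] = 0` at `v = p`
and the bad `v`», in the tree spelling of the `hloc` binder of `DeoRaySujatha2023.thm39_…`): no non-zero
`D_v`-fixed `p`-torsion point of `E[p^∞]` killed by `p`, for `v = p` and every prime of bad reduction.
(At `v = p` it follows from non-anomalous `a_p ≢ 1 (mod p)` for good ordinary `p ≥ 3`.)  A predicate.
[cite: DeoRaySujatha2023, §3 hypothesis (c3) and Thm. 3.9 (arXiv:2202.09937 pp. 9–10)] -/
def CleanAt (W : WeierstrassCurve ℚ) [W.IsElliptic] (p : ℕ) [Fact p.Prime] : Prop :=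
  ∀ v : HeightOneSpectrum (𝓞 ℚ), (((p : ℕ) : 𝓞 ℚ) ∈ v.asIdeal ∨ ¬ W.HasGoodReductionAt v) →
    ∀ x : W.geomPrimaryTorsion p, p • x = 0 →
      (∀ d ∈ Literature.NumberTheory.EllipticCurves.GreenbergSelmer.decomp v, d • x = x) → x = 0

/-- **`TameAt W p` — TAME image**: `p ∤ #Gal(ℚ(E[p])/ℚ)` (Deo–Ray–Sujatha's (c1) via their Lemma 5.1;
automatic when `E[p]` is irreducible and `ρ̄` is not onto, by Serre's classification of the proper
subgroups of `GL₂(𝔽_p)` — tree: `not_dvd_card_range_galoisRepTorsion_of_irreducible_of_not_surjective`).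
A predicate. [cite: DeoRaySujatha2023, §3 hypothesis (c1) and §5 Lemma 5.1 (p. 17)] [cite: Serre1972, §2 (proper subgroups of `GL₂(𝔽_p)`)] -/
def TameAt (W : WeierstrassCurve ℚ) [W.IsElliptic] (p : ℕ) [Fact p.Prime] : Prop :=
  haveI : NeZero p := ⟨(Fact.out : p.Prime).ne_zero⟩
  ¬ p ∣ Nat.card ((W.divisionField p) ≃ₐ[ℚ] (W.divisionField p))

/-- The torsion-point field `ℚ(P) ⊂ ℚ̄` of a geometric `p`-torsion point `P`: the fixed field of its
stabiliser in `Γ_ℚ` (the term used by `SmallImageMu.TorsionPointFieldMuSufficesOnClassX9`).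
[cite: DeoRaySujatha2023, §3 (the fields `L = F(E[p])` and their subfields)] -/
abbrev pointField (W : WeierstrassCurve ℚ) [W.IsElliptic] (p : ℕ) (P : geomTorsion W (p : ℤ)) :
    IntermediateField ℚ (AlgebraicClosure ℚ) :=
  IntermediateField.fixedField (MulAction.stabilizer (Field.absoluteGaloisGroup ℚ) P)

/-! ### §2 First-layer data of a `ℤ_p`-extension `κ` of a number field `F` -/

/-- **Mod-`p` capitulation in the first layer**: every ideal class of `F` becomes a `p`-th power in
`Cl(F₁)`, `F₁ = κ.layer 1`; i.e. the natural map `Cl(F)/p → Cl(F₁)/p` is ZERO.  (The binder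
`[NumberField (κ.layer 1)]` is a provable premise, kept explicit so that `ClassGroup.mk0` elaborates.)
A predicate on `κ`. [cite: Lang1990, Ch. 13 §1 Lemma 3 (first-layer behaviour of `p`-class groups)] -/
def ModPCapitulationInFirstLayer {F : Type} [Field F] [NumberField F] {p : ℕ} [Fact p.Prime]
    (κ : ZpExtension F p) : Prop :=
  ∀ [NumberField (κ.layer 1)],
    ∀ (I : (Ideal (𝓞 F))⁰) (J : (Ideal (𝓞 (κ.layer 1)))⁰),
      (J : Ideal (𝓞 (κ.layer 1))) = Ideal.map (algebraMap (𝓞 F) (𝓞 (κ.layer 1))) (I : Ideal (𝓞 F)) →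
      ClassGroup.mk0 J ∈
        (powMonoidHom p : ClassGroup (𝓞 (κ.layer 1)) →* ClassGroup (𝓞 (κ.layer 1))).range

/-- **Certificate δ at a pair**: for ONE non-zero `P ∈ E[p]` and every cyclotomic `ℤ_p`-extension `κ`
of `ℚ(P)`, `rank_p Cl(ℚ₁(P)) ≤ p − 1` (`classGroupPRank κ 1 < p`; `classGroupPRank` is the tree's
`dim_{𝔽_p} Cl(F₁)/p`).  A predicate (finitely checkable per pair: one class group of a degree-`8p`/`12p`/
`24p` field on X9, `4p`/`8p` on X10b). [cite: Lang1990, Ch. 13 §1 Lemma 3] [cite: DeoRaySujatha2023, Thm. 3.9 (the layer-0 certificate it refines)] -/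
def FirstLayerRankCertAt (W : WeierstrassCurve ℚ) [W.IsElliptic] (p : ℕ) [Fact p.Prime] : Prop :=
  ∃ P : geomTorsion W (p : ℤ), P ≠ 0 ∧
    ∀ κ : ZpExtension (pointField W p P) p, κ.IsCyclotomic → classGroupPRank κ 1 < p

/-- **Certificate ε at a pair**: mod-`p` capitulation of `Cl(ℚ(P))` in `ℚ₁(P)` for ONE non-zero `P`
and every cyclotomic `κ` of `ℚ(P)` (contains Deo–Ray–Sujatha's layer-0 certificate `p ∤ h(ℚ(P))`).
A predicate. [cite: DeoRaySujatha2023, Thm. 3.9 (b) (the case `p ∤ h`)] [cite: Lang1990, Ch. 13 §1 Lemma 3] -/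
def FirstLayerCapitulationCertAt (W : WeierstrassCurve ℚ) [W.IsElliptic] (p : ℕ) [Fact p.Prime] :
    Prop :=
  ∃ P : geomTorsion W (p : ℤ), P ≠ 0 ∧
    ∀ [NumberField (pointField W p P)],
      ∀ κ : ZpExtension (pointField W p P) p, κ.IsCyclotomic → ModPCapitulationInFirstLayer κ

/-! ### §3 Per-pair glue (the criteria enter as HYPOTHESES; nothing class-wide is asserted) -/

section Glue

variable {W : WeierstrassCurve ℚ} [W.IsElliptic] [W.IsGloballyMinimal] {p : ℕ} [Fact p.Prime]

/-- **Certificate ε + the capitulation criterion (hypothesis `hC`) ⟹ Kato's integral divisibility AT THE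
PAIR** (`KatoDivisibilityAt`), at `p ≥ 5` good ordinary with `E[p]` irreducible, granted BCS (a),
modularity, F1 (Kato's divisibility inputs with the fine quotient) and the bound `k ≤ μ(X₀)` at the pair
(`hSW`): `hC` gives statement (A), and the carriers' per-pair engine `ConjAAt.katoDivisibilityAt` does the
rest (T0 is a tree theorem).  The BC5-rung shape of the cell's crux. [cite: Kato2004Asterisque, Thm. 17.4 (p. 273) and §17.13 (pp. 279–280)]
[cite: DeoRaySujatha2023, Thm. 3.9 (the layer-0 case of the certificate)] -/
theorem katoDivisibilityAt_of_firstLayerCapitulationCert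
    (hC : ∀ (W : WeierstrassCurve ℚ) [W.IsElliptic] (p : ℕ) [Fact p.Prime], p ≠ 2 →
      W.HasIrreducibleModPGaloisRep p → TameAt W p → CleanAt W p →
      FirstLayerCapitulationCertAt W p → ConjAAt W p)
    (hBCS : burungale_castella_skinner_charIdeal_eq_padicLFunction)
    (hmodP : nonempty_modularParametrizationData)
    (hfine : Kato2004.exists_divisibilityInputs_fineQuotient) (hp : 5 ≤ p)
    (hgood : W.HasGoodReductionAtPrime p) (hord : ¬ (p : ℤ) ∣ W.frobeniusTrace p)
    (hirr : W.HasIrreducibleModPGaloisRep p) (hSW : MuDefectLeFineMuAt W p) (htame : TameAt W p)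
    (hclean : CleanAt W p) (hcert : FirstLayerCapitulationCertAt W p) : KatoDivisibilityAt W p :=
  (hC W p (by omega) hirr htame hclean hcert).katoDivisibilityAt hBCS hmodP hfine hp hgood hord hirr hSW

/-- **Certificate δ + the rank criterion (hypothesis `hC`) ⟹ Kato's integral divisibility AT THE PAIR.**
[cite: Kato2004Asterisque, Thm. 17.4 (p. 273) and §17.13 (pp. 279–280)] [cite: Lang1990, Ch. 13 §1 Lemma 3] -/
theorem katoDivisibilityAt_of_firstLayerRankCert
    (hC : ∀ (W : WeierstrassCurve ℚ) [W.IsElliptic] (p : ℕ) [Fact p.Prime], p ≠ 2 →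
      W.HasIrreducibleModPGaloisRep p → TameAt W p → CleanAt W p →
      FirstLayerRankCertAt W p → ConjAAt W p)
    (hBCS : burungale_castella_skinner_charIdeal_eq_padicLFunction)
    (hmodP : nonempty_modularParametrizationData)
    (hfine : Kato2004.exists_divisibilityInputs_fineQuotient) (hp : 5 ≤ p)
    (hgood : W.HasGoodReductionAtPrime p) (hord : ¬ (p : ℤ) ∣ W.frobeniusTrace p)
    (hirr : W.HasIrreducibleModPGaloisRep p) (hSW : MuDefectLeFineMuAt W p) (htame : TameAt W p)
    (hclean : CleanAt W p) (hcert : FirstLayerRankCertAt W p) : KatoDivisibilityAt W p :=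
  (hC W p (by omega) hirr htame hclean hcert).katoDivisibilityAt hBCS hmodP hfine hp hgood hord hirr hSW

/-- **… and with a unit coefficient of `L_p` (`MuAnZeroAt`, the census certificate) the pair has
`μ(X) = 0`** (`MuAlgZeroAt`): divisibility + unit content pin the generator (carrier lemma
`MuAlgZeroAt` road of `SmallImageMu.KatoDivisibilityEdges`, here per pair through any newform `f`).
[cite: GreenbergVatsal2000, p. 2 (2) and Prop. 3.7] [cite: BurungaleCastellaSkinner2025, Thm. 1.1.2 (a) (p. 2 of arXiv:2405.00270v2)] -/
theorem muAlgZeroAt_of_katoDivisibilityAt_of_muAnZeroAt'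
    (hBCS : burungale_castella_skinner_charIdeal_eq_padicLFunction) (hp : 5 ≤ p)
    (hgood : W.HasGoodReductionAtPrime p) (hord : ¬ (p : ℤ) ∣ W.frobeniusTrace p)
    (hirr : W.HasIrreducibleModPGaloisRep p) {N : ℕ} [NeZero N] {f : CuspForm (Gamma0 N) 2}
    (hf : IsNewformOf W f) (hdiv : KatoDivisibilityAt W p) (hcert : MuAnZeroAt W p) :
    MuAlgZeroAt W p := by
  intro κ γ hκ hγ hγ' D
  haveI : Module.Finite (IwasawaAlgebra p) D.X := D.module_finite_holds hγ
  obtain ⟨hX, g₀, k, hchar, -⟩ := hBCS W p κ γ f hp hgood hord hirr hκ hγ hγ' hf D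
  obtain ⟨g, hg, hιg⟩ := hdiv κ γ f hκ hγ hγ' hf D
  have hug : GreenbergVatsal2000.HasUnitContent g := hasUnitContent_of_map_eq g _ hιg (hcert f hf)
  have hug₀ : GreenbergVatsal2000.HasUnitContent g₀ := by
    rw [GreenbergVatsal2000.hasUnitContent_iff_not_C_dvd] at hug ⊢
    intro hdvd
    apply hug
    rw [hchar, Ideal.mem_span_singleton] at hg
    exact hdvd.trans hg
  exact (GreenbergVatsal2000.mu_eq_zero_iff_hasUnitContent D hX hchar).mpr hug₀

end Glue

end Literature.NumberTheory.EllipticCurves.Rank1Residual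

end
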